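import Summits.BirchSwinnertonDyer.Rank1Residual.GaloisImage.PrimeChoiceSelection
import Summits.BirchSwinnertonDyer.Rank1Residual.GaloisImage.PrimeChoiceLocal
import Literature.NumberTheory.GaloisRepresentations.LocalGlobalCohomologyProofs
import Literature.NumberTheory.GaloisRepresentations.FrobeniusDensity
import Literature.NumberTheory.GaloisRepresentations.CyclotomicDirichletDensity
import Literature.NumberTheory.GaloisCohomology.KolyvaginSystems
import Mathlib.Data.Fin.VecNotation
import HarnessLib

/-!
# Sakamoto's prime-choice lemma at `p = 3` (JTNB 36 (2024) Lemma 5.2 / Cor. 5.5) as a THEOREM: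
# infinitely many `𝔮 ∈ 𝒫` with `loc_𝔮 cᵢ ≠ 0` for `n ≤ p` non-zero classes
# (cell `b2b-bsdres`, team n1011, row T-C55K, file 4/5 — ASSEMBLY; seat p15)

HONEST FRAMING (cell `b2b-bsdres`, run/shared/lean/b2b/bsd-rank1-residual/, verbatim in every
file): the goal of the cell is to DELETE the COMBINATION-SHAPED residual classes of the
Birch–Swinnerton-Dyer formula for ALL analytic-rank `≤ 1` elliptic curves over `ℚ` — "full BSD
formula for every rank `≤ 1` curve in class `C`" assembled STRICTLY from published theorems — so
that the rank-`≤ 1` remainder becomes exactly the CONSTRUCTION-SHAPED classes, which are TYPED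
(missing-input `Prop`s), NOT attempted. This is not "finishing BSD". Team n1011 (N10/N11, the
additive block `X4 ∧ p = 3`): research route; TOOL theorems about Galois cohomology classes of a
finite Galois module, no class theorem, nothing booked, no mark changed; no definition, no named
fact.  The one deep input — Chebotarev's density theorem — is the tree's PROVED theorem
`GaloisRepresentations.chebotarevArtinRep_holds` (via `absoluteGaloisGroup.frobenius_dense`).

## Statement (main theorem `infinite_setOf_mem_frobeniusClassPrimes_forall_localization_ne_zero`)

Let `K` be a number field, `ρ` a FINITE discrete `Γ_K`-module on `M` (= `T̄`), `p` a prime, `N ≠ 0`,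
`S` a finite set of finite places, `τ ∈ Γ_K` with `T̄/(τ − 1)T̄ ≃ ℤ/p` (the (H.2) datum of
Sakamoto's `𝒫`), and assume
* (H.1) `hirr`: `T̄` has no `ρ`-stable subgroup other than `⊥`, `⊤`;
* (H.3) `hH3`: every continuous crossed homomorphism `Γ_K → T̄` vanishing on
  `Gal(K̄/K(T̄, μ_N)) = ker ρ ⊓ rootsOfUnityFixer K N` is principal (VERBATIM the shape of
  `InflationRestrictionSakamotoH3`, discharged there for `E[p]`, `p` odd, `ρ̄_{E,p}` onto).
Then for every `n ≤ p` and non-zero classes `c₁, …, cₙ ∈ H¹(K, T̄)`, the set of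
`𝔮 ∈ frobeniusClassPrimes ρ S τ N` (Sakamoto's `𝒫`: `𝔮 ∉ S`, `𝔮 ∤ N`, `T̄` unramified at `𝔮`,
`Fr_𝔮 ∼ τ` on `T̄` and on `μ_N`) with `loc_𝔮 cᵢ ≠ 0` for ALL `i` is INFINITE.  The corollary
`infinite_setOf_mem_frobeniusClassPrimes_localization_ne_zero_three` (three classes, `3 ≤ p`) is
LITERALLY the binder `hC55` of `CoreRankZero.kolyvaginSystems_eq_bot_of_hasCoreRank_zero_of_selfDual`
(R1-16) with `D.primes = frobeniusClassPrimes ρ S τ N` — Sakamoto, JTNB 36 (2024), Cor. 5.5: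
"Let `c₁, c₂, c₃ ∈ H¹(K, T̄)` be non-zero elements. Then there are infinitely many primes `𝔮 ∈ 𝒫`
satisfying `loc_𝔮(c_i) ≠ 0` for any `1 ≤ i ≤ 3`."  At `n = 4`, `p ≥ 5` it is the Chebotarev step of
Mazur–Rubin's Prop. 3.6.1 under (H.4b).

## Proof (Mazur–Rubin pp. 30–31 / Sakamoto Lemma 5.2, with the tree's inputs)

1. File 2 (`exists_forall_apply_mul_notMem_range`): `γ ∈ G_F` with `cᵢ(τγ) ∉ (τ − 1)T̄` for all `i`.
2. The set `U = {σ | ρ σ = ρ(τγ), σ ≡ τγ on μ_N, cᵢ(σ) = cᵢ(τγ) ∀ i}` is open (finite `T̄`,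
   discrete values) and contains `τγ`.
3. Frobenius elements at places outside any finite set `B` are dense
   (`absoluteGaloisGroup.frobenius_dense chebotarev_artinRep_of_galoisSide`); take `B = S ∪ T ∪
   {𝔮 ∣ N} ∪ Ram(ρ) ∪ ⋃ᵢ Ram(cᵢ)` (`T` arbitrary finite; the ramification sets are finite by
   `eventually_forall_inertia_mem_fixingSubgroup` applied to the open neighbourhoods `{ρ = 1}` and
   `{cᵢ = 0}` of `1`): some `σ ∈ U` is an arithmetic Frobenius at a prime `𝔓 ∣ 𝔮`, `𝔮 ∉ B`.
4. `𝔮 ∈ 𝒫` (as `ρ(σ τ⁻¹) = ρ(γ) = 1` and `σ τ⁻¹` fixes `μ_N`), and `loc_𝔮 cᵢ ≠ 0` by file 3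
   (`localization_oneCocycleClass_eq_zero_iff_of_isArithFrobAt`): `cᵢ(σ) = cᵢ(τγ) ∉ (τ − 1)T̄ =
   (ρ(σ) − 1)T̄`.
5. `𝔮 ∉ T` for every finite `T`: the good set is infinite.

References: B. Mazur, K. Rubin, *Kolyvagin systems*, Mem. AMS 799 (2004), Prop. 3.6.1
(pp. 30–31); R. Sakamoto, *The theory of Kolyvagin systems for p = 3*, JTNB 36 (2024), Lemma 5.2,
Cor. 5.5 (pp. 928–930); J. Tate, *Global class field theory* §2.4 (Chebotarev).
-/

noncomputable section

open Function Field NumberField IsDedekindDomain Filter Topology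
open Literature.NumberTheory.GaloisRepresentations Literature.NumberTheory.GaloisCohomology
open scoped NumberField Pointwise

namespace Summit.BirchSwinnertonDyer.Rank1Residual.GaloisImage.PrimeChoice

variable {K : Type} [Field K] [NumberField K] {M : Type} [AddCommGroup M] [TopologicalSpace M]
  [DiscreteTopology M] (ρ : DiscreteGaloisModule K M)

/-! ## Ramification is finite: inertia groups at almost all places lie in any neighbourhood of `1` -/

/-- **Inertia groups at almost all places lie in a given neighbourhood of `1 ∈ Γ_K`.**  A
neighbourhood of `1` contains `Gal(K̄/E)` for a finite normal `E/K` (Krull topology), and the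
inertia groups above `v` fix `E` for all but finitely many `v`
(`eventually_forall_inertia_mem_fixingSubgroup`: the ramified primes divide the different).
[cite: NeukirchANT1999, Ch. III §2 Thm. (2.6)] -/
theorem eventually_forall_inertia_mem_of_mem_nhds_one {U : Set (absoluteGaloisGroup K)}
    (hU : U ∈ 𝓝 (1 : absoluteGaloisGroup K)) :
    ∀ᶠ v : HeightOneSpectrum (𝓞 K) in cofinite, ∀ 𝔓 ∈ v.primesAbove,
      ∀ g ∈ 𝔓.inertia (absoluteGaloisGroup K), g ∈ U := by
  obtain ⟨E, hEfin, hEnormal, hEU⟩ :=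
    (krullTopology_mem_nhds_one_iff_of_normal K (AlgebraicClosure K) _).1 hU
  haveI := hEfin
  haveI := hEnormal
  haveI : IsGalois K E := IsGalois.mk
  filter_upwards [eventually_forall_inertia_mem_fixingSubgroup (F := K) E] with v hv
  intro 𝔓 h𝔓 g hg
  exact hEU (hv 𝔓 h𝔓 g hg)

/-- **A finite discrete Galois module is unramified at almost all places.**
[cite: SerreAbelianLadic1968, Ch. I §2.1] -/
theorem eventually_isUnramifiedAt [Finite M] :
    ∀ᶠ v : HeightOneSpectrum (𝓞 K) in cofinite, GaloisRep.IsUnramifiedAt v ρ := by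
  have hU : {σ : absoluteGaloisGroup K | ∀ m : M, ρ σ m = m} ∈ 𝓝 (1 : absoluteGaloisGroup K) := by
    refine IsOpen.mem_nhds ?_ (fun m => by rw [map_one, Module.End.one_apply])
    have h : {σ : absoluteGaloisGroup K | ∀ m : M, ρ σ m = m} = ⋂ m : M, {σ | ρ σ m = m} := by
      ext σ; simp [Set.mem_iInter]
    rw [h]
    exact isOpen_iInter_of_finite fun m => ρ.isOpen_setOf_apply_eq m
  filter_upwards [eventually_forall_inertia_mem_of_mem_nhds_one hU] with v hv
  intro 𝔓 h𝔓 g hg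
  exact LinearMap.ext fun m => hv 𝔓 h𝔓 g hg m

/-- **A continuous crossed homomorphism vanishes on the inertia groups at almost all places**
(Milne *ADT* I Lemma 4.8: cohomology classes are unramified almost everywhere).
[cite: MilneADT2006, Ch. I §4, Lemma 4.8] -/
theorem eventually_forall_inertia_apply_eq_zero (c : contOneCocycles ρ.toTopRep) :
    ∀ᶠ v : HeightOneSpectrum (𝓞 K) in cofinite, ∀ 𝔓 ∈ v.primesAbove,
      ∀ g ∈ 𝔓.inertia (absoluteGaloisGroup K), c.1 g = 0 := by
  have hU : {σ : absoluteGaloisGroup K | c.1 σ = 0} ∈ 𝓝 (1 : absoluteGaloisGroup K) :=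
    IsOpen.mem_nhds ((isOpen_discrete ({0} : Set M)).preimage c.1.continuous)
      (contOneCocycles.apply_one c)
  filter_upwards [eventually_forall_inertia_mem_of_mem_nhds_one hU] with v hv
  exact hv

/-! ## One good Kolyvagin prime outside any finite set -/

/-- **One prime of Sakamoto's `𝒫` outside any finite set `T` with `loc_𝔮 cᵢ ≠ 0` for all `i`**
(steps 1–4 of the module docstring: file 2's `γ`, the open set `U ∋ τγ`, a Frobenius in `U` by
`frobenius_dense`, file 3's criterion).
[cite: Sakamoto2024, Lemma 5.2 (p. 928)] [cite: MazurRubin2004, Prop. 3.6.1 proof, pp. 30–31] -/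
theorem exists_mem_frobeniusClassPrimes_notMem_forall_localization_ne_zero [Finite M]
    {p : ℕ} [Fact p.Prime] {N : ℕ} (hN : N ≠ 0)
    (S : Set (HeightOneSpectrum (𝓞 K))) (hS : S.Finite)
    {τ : absoluteGaloisGroup K} (e : cokerSubOne ρ τ ≃+ ZMod p)
    (hirr : ∀ A : AddSubgroup M,
      (∀ (s : absoluteGaloisGroup K), ∀ m ∈ A, ρ s m ∈ A) → A = ⊥ ∨ A = ⊤)
    (hH3 : ∀ f : contOneCocycles ρ.toTopRep,
      (∀ u : absoluteGaloisGroup K, ρ u = 1 → u ∈ rootsOfUnityFixer K N → f.1 u = 0) →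
        oneCocycleClass ρ.toTopRep f = 0)
    {n : ℕ} (hn : n ≤ p) (c : Fin n → contOneCocycles ρ.toTopRep)
    (hc : ∀ i, oneCocycleClass ρ.toTopRep (c i) ≠ 0)
    (T : Set (HeightOneSpectrum (𝓞 K))) (hT : T.Finite) :
    ∃ q ∈ frobeniusClassPrimes ρ S τ N, q ∉ T ∧
      ∀ i, galoisCohomology.localization ρ (Sum.inr q) 1 (oneCocycleClass ρ.toTopRep (c i)) ≠ 0 := by
  classical
  -- Step 1: the selection
  obtain ⟨γ, hγρ, hγμ, hγ⟩ := exists_forall_apply_mul_notMem_range e hirr hH3 hn c hc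
  set g₀ : absoluteGaloisGroup K := τ * γ with hg₀
  have hρg₀ : ρ g₀ = ρ τ := by rw [hg₀, map_mul, hγρ, mul_one]
  -- Step 2: the open set `U ∋ g₀`
  set U : Set (absoluteGaloisGroup K) :=
    {σ | (∀ m : M, ρ σ m = ρ g₀ m) ∧
      (∀ t : AlgebraicClosure K, t ^ N = 1 → σ • t = g₀ • t) ∧ ∀ i, (c i).1 σ = (c i).1 g₀}
    with hU_def
  haveI : NeZero N := ⟨hN⟩
  haveI : NeZero (N : K) := ⟨Nat.cast_ne_zero.mpr hN⟩
  have hUopen : IsOpen U := by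
    have h1 : IsOpen {σ : absoluteGaloisGroup K | ∀ m : M, ρ σ m = ρ g₀ m} := by
      have heq : {σ : absoluteGaloisGroup K | ∀ m : M, ρ σ m = ρ g₀ m} =
          (fun σ => g₀⁻¹ * σ) ⁻¹' ⋂ m : M, {σ | ρ σ m = m} := by
        ext σ
        simp only [Set.mem_setOf_eq, Set.mem_preimage, Set.mem_iInter, map_mul,
          Module.End.mul_apply]
        refine forall_congr' fun m => ⟨fun h => ?_, fun h => ?_⟩
        · rw [h, ← Module.End.mul_apply, ← map_mul, inv_mul_cancel, map_one, Module.End.one_apply]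
        · have h' := congrArg (ρ g₀) h
          rwa [← Module.End.mul_apply, ← map_mul, mul_inv_cancel, map_one, Module.End.one_apply] at h'
      rw [heq]
      exact (isOpen_iInter_of_finite fun m => ρ.isOpen_setOf_apply_eq m).preimage
        (continuous_const.mul continuous_id)
    have h2 : IsOpen {σ : absoluteGaloisGroup K | ∀ t : AlgebraicClosure K, t ^ N = 1 → σ • t = g₀ • t} := by
      have heq : {σ : absoluteGaloisGroup K | ∀ t : AlgebraicClosure K, t ^ N = 1 → σ • t = g₀ • t} =
          (fun σ => g₀⁻¹ * σ) ⁻¹' (rootsOfUnityFixer K N : Set (absoluteGaloisGroup K)) := by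
        ext σ
        simp only [Set.mem_setOf_eq, Set.mem_preimage, SetLike.mem_coe, mem_rootsOfUnityFixer_iff,
          mul_smul, inv_smul_eq_iff]
      rw [heq]
      exact (isOpen_rootsOfUnityFixer K N).preimage (continuous_const.mul continuous_id)
    have h3 : IsOpen {σ : absoluteGaloisGroup K | ∀ i, (c i).1 σ = (c i).1 g₀} := by
      have heq : {σ : absoluteGaloisGroup K | ∀ i, (c i).1 σ = (c i).1 g₀} =
          ⋂ i, (c i).1 ⁻¹' {(c i).1 g₀} := by
        ext σ; simp [Set.mem_iInter]
      rw [heq]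
      exact isOpen_iInter_of_finite fun i => (isOpen_discrete _).preimage (c i).1.continuous
    simpa only [hU_def, Set.setOf_and] using h1.inter (h2.inter h3)
  have hg₀U : g₀ ∈ U := ⟨fun _ => rfl, fun _ _ => rfl, fun _ => rfl⟩
  -- Step 3: the finite set of bad places and a Frobenius in `U` away from it
  set B : Set (HeightOneSpectrum (𝓞 K)) :=
    S ∪ T ∪ {v | ((N : ℕ) : 𝓞 K) ∈ v.asIdeal} ∪ {v | ¬ GaloisRep.IsUnramifiedAt v ρ} ∪
      {v | ¬ ∀ i, ∀ 𝔓 ∈ v.primesAbove, ∀ g ∈ 𝔓.inertia (absoluteGaloisGroup K), (c i).1 g = 0}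
    with hB_def
  have hBfin : B.Finite := by
    refine (((hS.union hT).union (finite_setOf_natCast_mem (K := K) (m := N))).union ?_).union ?_
    · exact eventually_cofinite.1 (eventually_isUnramifiedAt ρ)
    · exact eventually_cofinite.1
        (eventually_all.2 fun i => eventually_forall_inertia_apply_eq_zero ρ (c i))
  have hdense := absoluteGaloisGroup.frobenius_dense
    Literature.NumberTheory.Automorphic.chebotarev_artinRep_of_galoisSide K B hBfin
  obtain ⟨σ, ⟨v, hvB, 𝔓, h𝔓, hσ𝔓⟩, hσU⟩ := hdense.exists_mem_open hUopen ⟨g₀, hg₀U⟩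
  simp only [hB_def, Set.mem_union, Set.mem_setOf_eq, not_or, not_not] at hvB
  obtain ⟨⟨⟨⟨hvS, hvT⟩, hvN⟩, hunr⟩, hcI⟩ := hvB
  obtain ⟨hσρ, hσμ, hσc⟩ := hσU
  have hρσ : ρ σ = ρ τ := (LinearMap.ext hσρ).trans hρg₀
  -- Step 4: `v ∈ 𝒫` and the localisations are non-zero
  refine ⟨v, ⟨hvS, hvN, hunr, σ, ⟨𝔓, h𝔓, hσ𝔓⟩, fun m => ?_, fun ζ hζ => ?_⟩, hvT, fun i => ?_⟩
  · rw [map_mul, hρσ, ← map_mul, mul_inv_cancel, map_one, Module.End.one_apply]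
  · have hζ' : (τ⁻¹ • ζ) ^ N = 1 := by rw [← smul_pow', hζ, smul_one]
    rw [mul_smul, hσμ _ hζ', hg₀, mul_smul, (mem_rootsOfUnityFixer_iff.mp hγμ) _ hζ',
      smul_inv_smul]
  · rw [Ne, localization_oneCocycleClass_eq_zero_iff_of_isArithFrobAt ρ v hunr (c i) (hcI i) h𝔓 hσ𝔓,
      hσc i, hρσ]
    exact hγ i

/-! ## The theorems -/

/-- **Sakamoto's prime choice (JTNB 36 (2024) Lemma 5.2 / Cor. 5.5; Mazur–Rubin Prop. 3.6.1 without
(H.4b)) — THEOREM.**  For a number field `K`, a finite discrete `Γ_K`-module `T̄` with (H.1) and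
(H.3) (tree shapes), `τ` with `T̄/(τ − 1)T̄ ≃ ℤ/p`, `N ≠ 0`, `S` finite, and `n ≤ p` NON-ZERO
classes `c₁, …, cₙ ∈ H¹(K, T̄)`: **infinitely many `𝔮 ∈ frobeniusClassPrimes ρ S τ N` have
`loc_𝔮 cᵢ ≠ 0` for every `i`.**  No hypothesis on `p` beyond `n ≤ p`: at `p = 3` three classes,
at `p ≥ 5` Mazur–Rubin's `2 + 2`.  Inputs: files 1–3 of this row and the tree's PROVED Chebotarev
(`chebotarevArtinRep_holds` through `absoluteGaloisGroup.frobenius_dense`).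
[cite: Sakamoto2024, Lemma 5.2 and Cor. 5.5 (pp. 928–930)]
[cite: MazurRubin2004, Prop. 3.6.1 (pp. 30–31)] -/
theorem infinite_setOf_mem_frobeniusClassPrimes_forall_localization_ne_zero [Finite M]
    {p : ℕ} [Fact p.Prime] {N : ℕ} (hN : N ≠ 0)
    (S : Set (HeightOneSpectrum (𝓞 K))) (hS : S.Finite)
    {τ : absoluteGaloisGroup K} (hτ : Nonempty (cokerSubOne ρ τ ≃+ ZMod p))
    (hirr : ∀ A : AddSubgroup M,
      (∀ (s : absoluteGaloisGroup K), ∀ m ∈ A, ρ s m ∈ A) → A = ⊥ ∨ A = ⊤)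
    (hH3 : ∀ f : contOneCocycles ρ.toTopRep,
      (∀ u : absoluteGaloisGroup K, ρ u = 1 → u ∈ rootsOfUnityFixer K N → f.1 u = 0) →
        oneCocycleClass ρ.toTopRep f = 0)
    {n : ℕ} (hn : n ≤ p) (c : Fin n → galoisCohomology ρ 1) (hc : ∀ i, c i ≠ 0) :
    {q | q ∈ frobeniusClassPrimes ρ S τ N ∧
      ∀ i, galoisCohomology.localization ρ (Sum.inr q) 1 (c i) ≠ 0}.Infinite := by
  classical
  choose φ hφ using fun i => oneCocycleClass_surjective ρ.toTopRep (c i)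
  have hφne : ∀ i, oneCocycleClass ρ.toTopRep (φ i) ≠ 0 := fun i => by rw [hφ i]; exact hc i
  intro hfin
  obtain ⟨q, hq, hqT, hloc⟩ :=
    exists_mem_frobeniusClassPrimes_notMem_forall_localization_ne_zero ρ hN S hS hτ.some hirr hH3
      hn φ hφne _ hfin
  exact hqT ⟨hq, fun i => by rw [← hφ i]; exact hloc i⟩

/-- **The binder `hC55` of R1-16 DISCHARGED** (three classes; `3 ≤ p`): for non-zero
`c₁, c₂, c₃ ∈ H¹(K, T̄)` there are infinitely many `𝔮 ∈ frobeniusClassPrimes ρ S τ N` with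
`loc_𝔮 c₁ ≠ 0 ∧ loc_𝔮 c₂ ≠ 0 ∧ loc_𝔮 c₃ ≠ 0` — LITERALLY the shape of the hypothesis `hC55` of
`CoreRankZero.kolyvaginSystems_eq_bot_of_hasCoreRank_zero_of_selfDual` /
`CoreRankZero.kummer_kolyvaginSystems_eq_bot[_rat]` when `D.primes = frobeniusClassPrimes ρ S τ N`.
Sakamoto, JTNB 36 (2024), Cor. 5.5 (p. 929): "Let `c₁, c₂, c₃ ∈ H¹(K, T̄)` be non-zero elements.
Then there are infinitely many primes `𝔮 ∈ 𝒫` satisfying `loc_𝔮(c_i) ≠ 0` for any `1 ≤ i ≤ 3`."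
[cite: Sakamoto2024, Cor. 5.5 (p. 929)] -/
theorem infinite_setOf_mem_frobeniusClassPrimes_localization_ne_zero_three [Finite M]
    {p : ℕ} [Fact p.Prime] (hp : 3 ≤ p) {N : ℕ} (hN : N ≠ 0)
    (S : Set (HeightOneSpectrum (𝓞 K))) (hS : S.Finite)
    {τ : absoluteGaloisGroup K} (hτ : Nonempty (cokerSubOne ρ τ ≃+ ZMod p))
    (hirr : ∀ A : AddSubgroup M,
      (∀ (s : absoluteGaloisGroup K), ∀ m ∈ A, ρ s m ∈ A) → A = ⊥ ∨ A = ⊤)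
    (hH3 : ∀ f : contOneCocycles ρ.toTopRep,
      (∀ u : absoluteGaloisGroup K, ρ u = 1 → u ∈ rootsOfUnityFixer K N → f.1 u = 0) →
        oneCocycleClass ρ.toTopRep f = 0) :
    ∀ c₁ c₂ c₃ : galoisCohomology ρ 1, c₁ ≠ 0 → c₂ ≠ 0 → c₃ ≠ 0 →
      {q ∈ frobeniusClassPrimes ρ S τ N | galoisCohomology.localization ρ (Sum.inr q) 1 c₁ ≠ 0 ∧
        galoisCohomology.localization ρ (Sum.inr q) 1 c₂ ≠ 0 ∧
        galoisCohomology.localization ρ (Sum.inr q) 1 c₃ ≠ 0}.Infinite := by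
  intro c₁ c₂ c₃ h₁ h₂ h₃
  have hc : ∀ i : Fin 3, ![c₁, c₂, c₃] i ≠ 0 := by
    intro i
    fin_cases i
    · exact h₁
    · exact h₂
    · exact h₃
  refine (infinite_setOf_mem_frobeniusClassPrimes_forall_localization_ne_zero ρ hN S hS hτ hirr hH3
    hp ![c₁, c₂, c₃] hc).mono ?_
  rintro q ⟨hq, h⟩
  exact ⟨hq, h 0, h 1, h 2⟩

end Summit.BirchSwinnertonDyer.Rank1Residual.GaloisImage.PrimeChoice

end
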